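import Mathlib
import Literature.Barriers.ValiantsHypothesis.AlgebraicNaturalProofs
import Literature.Barriers.ValiantsHypothesis.GKSS17NaturalProofsPIT
import Literature.Computability.AlgebraicComplexity.CircuitConstantCount
import Summits.ValiantsHypothesis.ValiantsHypothesis.Theorems.BarrierLeverDefinableEquationsDegreeWindow
import HarnessLib

/-!
# Crux `BarrierLever.DefinableEquations` (stmt-8745) ⟺ `SingleSizeEquations` (stmt-8749) —
# the degree window is THIN: nonzero equations in the degree-`d` coefficients alone exist for
# every polynomial of complexity `≤ s` as soon as `4s + 1 < C(n+d-1, d)`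

Sibling of `BarrierLeverDefinableEquationsDegreeWindow.lean` (the degree-window DOOR, seat
val-np-p5 gen 22).  That file shows: a level-`a` Boolean-sum equation in the `C(n+d-1,d)`
degree-`d` coefficient variables vanishing on the degree-`d` FORMS of size `≤ (d+2)² n^b` is a
witness of the crux at `b`.  Here: the door is not vacuous, by the CONSTANT COUNT of the tree's
`Literature/Computability/AlgebraicComplexity/CircuitConstantCount.lean` (Paterson–Stockmeyer /
Heintz–Schnorr / BCS §9.1, Thm. (9.13): a fan-in-two circuit of size `s` carries `≤ 4s + 1`
constants, finitely many skeletons, transcendence degree): the coefficient vectors of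
`{g | L(g) ≤ s}` project to a PROPER subvariety of every coordinate subspace of dimension
`> 4s + 1` — in particular of the degree-`d` window.

* §1 `exists_windowEquation` — `4s + 1 < C(n+d-1,d)` ⇒ a NONZERO polynomial in the degree-`d`
  coefficient variables (`GKSS2017.homMonomials n d`) vanishes at `coeff_d(g)` for EVERY `g` with
  `L(g) ≤ s` (no degree hypothesis on `g`); `exists_windowEquation_forms` (the door's class
  `W_d(n,b)`: forms of degree `d` and size `≤ (d+2)² n^b`, when `4(d+2)²n^b + 1 < C(n+d-1,d)`);
  `exists_windowEquation_smallCircuits` (the window of `SmallCircuits ℂ n b`, when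
  `4 n^b + 1 < C(n+d-1,d)`).
* §2 counting: `pow_le_factorial_mul_choose` (`n^d ≤ d! · C(n+d-1, d)`), and the window
  `d = b + 1` is thin EVENTUALLY in `n` for every `b` (`eventually_thin_succ`,
  `exists_windowEquation_forms_eventually`): the crux at `b` has a non-vacuous door in CONSTANT
  degree `b + 1` — one power of `n` below the generic size `≈ n^{b+1}/(4 (b+1)!)` of degree-`(b+1)`
  forms (`exists_form_complexity_gt`: some degree-`d` form needs `> (C(n+d-1,d) - 2)/4` gates).
* §3 the open rung `b = 2`: the CUBIC window of size-`n²` polynomials is thin from `n = 23` on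
  (`cubicWindow_thin_two`: `4n² + 1 < C(n+2,3)`), the door's class of cubic forms of size `≤ 25n²`
  from `n = 599` on (`cubicForms_thin_two`).

Honest framing: existence by a dimension count, nothing explicit; the EXPLICITNESS (level-`a`
Boolean sums, budget `N^a = 2^{O(n)}`) of a window equation is exactly what the crux asks; 8745/8749
stay OPEN at `b = 2` (Chatterjee–Tengse 2023 §1.3 dir. 2); nothing on crux 14610 or `VP ≠ VNP`, which
is NOT proved.  Route-independent (no `Theses` import).  No definitions, no named facts; standard
axioms.

References: Bürgisser–Clausen–Shokrollahi 1997, §9.1, Prop. (9.2), Thm. (9.13); J. Heintz,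
C.-P. Schnorr, STOC 1980 (Basic Theorem); Forbes–Shpilka–Volk 2018, Def. 1; Grochow–Kumar–Saks–Saraf
2017 §2.1 (`#` degree-`d` monomials).
-/

set_option linter.dupNamespace false

noncomputable section

namespace Summit.ValiantsHypothesis.ValiantsHypothesis.Theorems.BarrierLeverDefinableEquations

open MvPolynomial
open Literature.Computability.AlgebraicComplexity Literature.Barriers.ValiantsHypothesis
open scoped BigOperators

namespace DegreeWindow

/-! ## §1 Window equations exist by the constant count -/

/-- **The degree window is thin.** If `4s + 1 < C(n+d-1, d)` then some NONZERO polynomial in the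
degree-`d` coefficient variables vanishes at `coeff_d(g)` for every `g ∈ ℂ[x_1..x_n]` of circuit
complexity `≤ s` (any degree). [cite: BurgisserClausenShokrollahi1997, §9.1 and Thm. (9.13)] -/
theorem exists_windowEquation {n d s : ℕ} (h : 4 * s + 1 < (n + d - 1).choose d) :
    ∃ E : MvPolynomial (GKSS2017.homMonomials n d) ℂ, E ≠ 0 ∧
      ∀ g : MvPolynomial (Fin n) ℂ, complexity g ≤ s →
        eval (coeffVector (GKSS2017.homMonomials n d) g) E = 0 := by
  classical
  haveI := finite_homMonomials n d
  haveI : Fintype (GKSS2017.homMonomials n d) := Fintype.ofFinite _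
  set K := Fintype.card (GKSS2017.homMonomials n d) with hK
  have hKcard : K = (n + d - 1).choose d := by
    rw [hK, ← Nat.card_eq_fintype_card, natCard_homMonomials]
  let e : GKSS2017.homMonomials n d ≃ Fin K := Fintype.equivFin _
  obtain ⟨D, hD0, hD⟩ := exists_equation_of_complexity_le (F := ℂ) (σ := Fin n) s
    (K := K) (by rw [hKcard]; exact h) (fun i => ((e.symm i : GKSS2017.homMonomials n d) : Fin n →₀ ℕ))
  refine ⟨rename e.symm D, fun h0 => hD0 (rename_injective _ e.symm.injective
    (by rw [h0, map_zero])), fun g hg => ?_⟩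
  rw [eval_rename]
  exact hD g hg

/-- **The door's class is thin**: if `4 (d+2)² n^b + 1 < C(n+d-1, d)`, a nonzero window
polynomial vanishes at `coeff_d(g)` for every FORM `g` of degree `d` and circuit size
`≤ (d+2)² n^b` (indeed for every `g` of that size). [cite: BurgisserClausenShokrollahi1997, Thm. (9.13)] -/
theorem exists_windowEquation_forms {n b d : ℕ}
    (h : 4 * ((d + 2) ^ 2 * n ^ b) + 1 < (n + d - 1).choose d) :
    ∃ E : MvPolynomial (GKSS2017.homMonomials n d) ℂ, E ≠ 0 ∧
      ∀ g : MvPolynomial (Fin n) ℂ, g.IsHomogeneous d → complexity g ≤ (d + 2) ^ 2 * n ^ b →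
        eval (coeffVector (GKSS2017.homMonomials n d) g) E = 0 := by
  obtain ⟨E, hE0, hE⟩ := exists_windowEquation h
  exact ⟨E, hE0, fun g _ hg => hE g hg⟩

/-- **The window of `SmallCircuits ℂ n b` is thin**: if `4 n^b + 1 < C(n+d-1, d)`, a nonzero
polynomial in the degree-`d` coefficient variables vanishes at `coeff_d(f)` for every
`f ∈ SmallCircuits ℂ n b`. [cite: BurgisserClausenShokrollahi1997, Thm. (9.13)] -/
theorem exists_windowEquation_smallCircuits {n b d : ℕ} (h : 4 * n ^ b + 1 < (n + d - 1).choose d) :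
    ∃ E : MvPolynomial (GKSS2017.homMonomials n d) ℂ, E ≠ 0 ∧
      ∀ f ∈ SmallCircuits ℂ n b, eval (coeffVector (GKSS2017.homMonomials n d) f) E = 0 := by
  obtain ⟨E, hE0, hE⟩ := exists_windowEquation h
  exact ⟨E, hE0, fun f hf => hE f hf.2⟩

/-- **Pulled back to the crux's `N` coordinates** (`d ≤ n`): a nonzero polynomial in the
`C(2n,n)` coefficient variables, involving only degree-`d` coordinates, vanishing on
`coeff(SmallCircuits ℂ n b)`. [cite: BurgisserClausenShokrollahi1997, Thm. (9.13)] -/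
theorem exists_equation_smallCircuits_of_window {n b d : ℕ} (hd : d ≤ n)
    (h : 4 * n ^ b + 1 < (n + d - 1).choose d) :
    ∃ E : MvPolynomial (degLEMonomials n) ℂ, E ≠ 0 ∧
      (∀ ν ∈ E.vars, ((ν : degLEMonomials n) : Fin n →₀ ℕ).degree = d) ∧
      ∀ f ∈ SmallCircuits ℂ n b, eval (coeffVector (degLEMonomials n) f) E = 0 := by
  classical
  obtain ⟨E, hE0, hE⟩ := exists_windowEquation_smallCircuits h
  refine ⟨rename (Set.inclusion (homMonomials_subset_degLE hd)) E, rename_inclusion_ne_zero hd hE0,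
    fun ν hν => ?_, fun f hf => by rw [eval_rename_inclusion hd]; exact hE f hf⟩
  obtain ⟨μ, -, rfl⟩ := Finset.mem_image.1 (vars_rename _ _ hν)
  exact μ.2

/-- **Existential lower bound for forms** (Paterson–Stockmeyer type, total complexity): if
`4s + 1 < C(n+d-1, d)` then some degree-`d` FORM in `n` variables has circuit complexity `> s`
(a monomial `x^μ` of degree `d` with all degree-`d` coefficients prescribed generically is not
annihilated). [cite: BurgisserClausenShokrollahi1997, Prop. (9.2) and Thm. (9.13)] -/
theorem exists_form_complexity_gt {n d s : ℕ} (h : 4 * s + 1 < (n + d - 1).choose d) :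
    ∃ g : MvPolynomial (Fin n) ℂ, g.IsHomogeneous d ∧ s < complexity g := by
  classical
  obtain ⟨E, hE0, hE⟩ := exists_windowEquation (n := n) (d := d) h
  haveI := finite_homMonomials n d
  haveI : Fintype (GKSS2017.homMonomials n d) := Fintype.ofFinite _
  -- a point of the window where `E ≠ 0`
  obtain ⟨c, hc⟩ : ∃ c : GKSS2017.homMonomials n d → ℂ, eval c E ≠ 0 := by
    by_contra hcon
    push Not at hcon
    exact hE0 (funext_iff.mpr fun c => by rw [hcon c, map_zero]) |>.elim
  -- the form with these degree-`d` coefficients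
  let g : MvPolynomial (Fin n) ℂ := ∑ μ : GKSS2017.homMonomials n d, monomial (μ : Fin n →₀ ℕ) (c μ)
  have hcoeff : coeffVector (GKSS2017.homMonomials n d) g = c := by
    funext ν
    rw [coeffVector_apply]
    change coeff (ν : Fin n →₀ ℕ) (∑ μ : GKSS2017.homMonomials n d, monomial (μ : Fin n →₀ ℕ) (c μ)) = c ν
    rw [coeff_sum, Finset.sum_eq_single ν]
    · rw [coeff_monomial, if_pos rfl]
    · intro μ _ hμν
      rw [coeff_monomial, if_neg]
      exact fun h => hμν (Subtype.ext h)
    · intro hν; exact absurd (Finset.mem_univ ν) hν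
  refine ⟨g, ?_, ?_⟩
  · refine IsHomogeneous.sum _ _ _ fun μ _ => ?_
    have hμ : (μ : Fin n →₀ ℕ).degree = d := μ.2
    exact isHomogeneous_monomial _ hμ
  · by_contra hle
    push Not at hle
    exact hc (by rw [← hcoeff]; exact hE g hle)

/-! ## §2 Counting: the window `d = b + 1` is thin eventually in `n` -/

/-- `n^d ≤ d! · C(n + d - 1, d)` (`d! · C(n+d-1, d) = n (n+1) ⋯ (n+d-1)`). [folklore] -/
theorem pow_le_factorial_mul_choose (n d : ℕ) : n ^ d ≤ d.factorial * (n + d - 1).choose d := by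
  rcases Nat.eq_zero_or_pos d with rfl | hd
  · simp
  rcases Nat.eq_zero_or_pos n with rfl | hn
  · rw [zero_pow hd.ne']; exact Nat.zero_le _
  rw [← Nat.descFactorial_eq_factorial_mul_choose]
  calc n ^ d = (n + d - 1 + 1 - d) ^ d := by congr 1; omega
    _ ≤ (n + d - 1).descFactorial d := Nat.pow_sub_le_descFactorial (n + d - 1) d

/-- **Eventually thin at `d = b + 1`**: for `n ≥ (b+1)! · (K + 1) + 1`, `K n^b + 1 < C(n + b, b + 1)`.
[folklore] -/
theorem eventually_thin_succ (b K : ℕ) {n : ℕ} (hn : (b + 1).factorial * (K + 1) + 1 ≤ n) :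
    K * n ^ b + 1 < (n + (b + 1) - 1).choose (b + 1) := by
  have hn1 : 1 ≤ n := le_trans (by omega) hn
  have hfac : 1 ≤ (b + 1).factorial := Nat.one_le_iff_ne_zero.mpr (Nat.factorial_ne_zero _)
  have h1 := pow_le_factorial_mul_choose n (b + 1)
  -- `(b+1)! (K n^b + 1) < n^{b+1}`
  have hnb : 1 ≤ n ^ b := Nat.one_le_pow _ _ hn1
  have h2 : (b + 1).factorial * (K * n ^ b + 1) < n ^ (b + 1) := by
    calc (b + 1).factorial * (K * n ^ b + 1)
        ≤ (b + 1).factorial * (K * n ^ b + n ^ b) := by gcongr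
      _ = ((b + 1).factorial * (K + 1)) * n ^ b := by ring
      _ < n * n ^ b := Nat.mul_lt_mul_of_pos_right (by omega) (by omega)
      _ = n ^ (b + 1) := by ring
  by_contra hcon
  push Not at hcon
  have h3 : (b + 1).factorial * (n + (b + 1) - 1).choose (b + 1) ≤
      (b + 1).factorial * (K * n ^ b + 1) := Nat.mul_le_mul_left _ hcon
  omega

/-- **The door's class `W_{b+1}(n, b)` is thin eventually**: for every `b` there is `n₀` such that
for all `n ≥ n₀` a nonzero polynomial in the degree-`(b+1)` coefficient variables vanishes at
`coeff_{b+1}(g)` for every form `g` of degree `b + 1` and size `≤ (b+3)² n^b`.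
[cite: BurgisserClausenShokrollahi1997, Thm. (9.13)] -/
theorem exists_windowEquation_forms_eventually (b : ℕ) : ∃ n₀ : ℕ, ∀ n ≥ n₀,
    ∃ E : MvPolynomial (GKSS2017.homMonomials n (b + 1)) ℂ, E ≠ 0 ∧
      ∀ g : MvPolynomial (Fin n) ℂ, g.IsHomogeneous (b + 1) →
        complexity g ≤ (b + 1 + 2) ^ 2 * n ^ b →
        eval (coeffVector (GKSS2017.homMonomials n (b + 1)) g) E = 0 := by
  refine ⟨(b + 1).factorial * (4 * (b + 3) ^ 2 + 1) + 1, fun n hn => ?_⟩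
  apply exists_windowEquation_forms
  have h := eventually_thin_succ b (4 * (b + 3) ^ 2) hn
  have heq : 4 * ((b + 1 + 2) ^ 2 * n ^ b) = 4 * (b + 3) ^ 2 * n ^ b := by ring
  rw [heq]
  exact h

/-- **The window of `SmallCircuits ℂ n b` at `d = b + 1` is thin eventually** (`n ≥ 5 (b+1)! + 1`).
[cite: BurgisserClausenShokrollahi1997, Thm. (9.13)] -/
theorem exists_windowEquation_smallCircuits_eventually (b : ℕ) {n : ℕ}
    (hn : (b + 1).factorial * 5 + 1 ≤ n) :
    ∃ E : MvPolynomial (GKSS2017.homMonomials n (b + 1)) ℂ, E ≠ 0 ∧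
      ∀ f ∈ SmallCircuits ℂ n b, eval (coeffVector (GKSS2017.homMonomials n (b + 1)) f) E = 0 :=
  exists_windowEquation_smallCircuits (eventually_thin_succ b 4 hn)

/-! ## §3 The open rung `b = 2`: cubic windows -/

/-- **At `b = 2` the cubic window of size-`n²` polynomials is thin from `n = 23` on**
(`4n² + 1 < C(n+2, 3) = n(n+1)(n+2)/6`). [cite: BurgisserClausenShokrollahi1997, Thm. (9.13)] -/
theorem cubicWindow_thin_two {n : ℕ} (hn : 23 ≤ n) :
    ∃ E : MvPolynomial (GKSS2017.homMonomials n 3) ℂ, E ≠ 0 ∧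
      ∀ f ∈ SmallCircuits ℂ n 2, eval (coeffVector (GKSS2017.homMonomials n 3) f) E = 0 := by
  apply exists_windowEquation_smallCircuits
  have h6 : 6 * (n + 3 - 1).choose 3 = (n + 3 - 1).descFactorial 3 := by
    rw [Nat.descFactorial_eq_factorial_mul_choose]; norm_num
  have hdesc : (n + 3 - 1).descFactorial 3 = (n + 2) * (n + 1) * n := by
    rw [show n + 3 - 1 = n + 2 by omega]
    simp [Nat.descFactorial_succ, Nat.descFactorial_zero]
    ring_nf
  have key : 6 * (4 * n ^ 2 + 1) < (n + 2) * (n + 1) * n := by nlinarith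
  omega

/-- **At `b = 2` the door's class of CUBIC FORMS of size `≤ 25 n²` is thin from `n = 599` on**
(`100 n² + 1 < C(n+2, 3)`): a nonzero polynomial in the `C(n+2,3)` cubic coefficients vanishes on
every cubic form in `n` variables of circuit size `≤ 25 n²`; an EXPLICIT such polynomial
(level-`a` Boolean sum, budget `N^a = C(2n,n)^a`) would settle the crux at its open rung.
[cite: BurgisserClausenShokrollahi1997, Thm. (9.13)] -/
theorem cubicForms_thin_two {n : ℕ} (hn : 599 ≤ n) :
    ∃ E : MvPolynomial (GKSS2017.homMonomials n 3) ℂ, E ≠ 0 ∧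
      ∀ g : MvPolynomial (Fin n) ℂ, g.IsHomogeneous 3 → complexity g ≤ (3 + 2) ^ 2 * n ^ 2 →
        eval (coeffVector (GKSS2017.homMonomials n 3) g) E = 0 := by
  apply exists_windowEquation_forms
  have h6 : 6 * (n + 3 - 1).choose 3 = (n + 3 - 1).descFactorial 3 := by
    rw [Nat.descFactorial_eq_factorial_mul_choose]; norm_num
  have hdesc : (n + 3 - 1).descFactorial 3 = (n + 2) * (n + 1) * n := by
    rw [show n + 3 - 1 = n + 2 by omega]
    simp [Nat.descFactorial_succ, Nat.descFactorial_zero]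
    ring_nf
  have key : 6 * (4 * ((3 + 2) ^ 2 * n ^ 2) + 1) < (n + 2) * (n + 1) * n := by nlinarith
  omega

end DegreeWindow

end Summit.ValiantsHypothesis.ValiantsHypothesis.Theorems.BarrierLeverDefinableEquations
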